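import Summits.ResolutionOfSingularities.ResolutionOfSingularities.Theorems.UniversalCellsLocalToGlobalHSTowerDefs
import HarnessLib

/-!
# `LocalToGlobal` (crux stmt-ResolutionOfSingularities-15232, route UniversalCells), line `Sketch`
# (idea `existence-certified-termination`) — stub `stub_hasResolution_of_isRegular_iter`

Helper file (`--supports stmt-ResolutionOfSingularities-15232`; does not close the item).
Objects: `Theorems/UniversalCellsLocalToGlobalHSTowerDefs.lean` (the blind lex-maximal
Hilbert–Samuel tower: `hsCentre`, `hsStep`, `NormalVariety.step`, `stepπ`, `iterπ`, `IsResolvedOver`).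

Statement: for a normal variety `V` over a field `k` and the blind tower
`V_n := (NormalVariety.step N)^[n] V`, if the stage `V_n` is regular then `V.X` has a resolution of
singularities (`Scheme.HasResolution V.X`). Proof (the tree's
`NormalSurface.hasResolution_of_iterate` / `hasResolution_of_isRegular_iterate`,
`LipmanProcedure.lean`, transposed from `NormalSurface` to `NormalVariety`): resolutions descend
along one blind step `V.stepπ N : (V.step N).X ⟶ V.X`, which is proper (instance
`NormalVariety.isProper_stepπ`) and birational (`NormalVariety.isBirational_stepπ`), by
`Scheme.HasResolution.of_isBirational` (`QuasiProjectiveResolution.lean`); then induction on `n`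
simultaneously for all `V`, using `Function.iterate_succ_apply : f^[n+1] V = f^[n] (f V)` to apply
the induction hypothesis to `V.step N`; the base case is `Function.iterate_zero`, and a regular
scheme resolves itself (`Scheme.IsRegular.hasResolution`, `ResolutionOfSingularities.lean`).
Source of the argument: Liu 2002, §8.3.4, (3.11) and Thm. 8.3.44 (p. 362). [Liu2002]
-/

set_option linter.dupNamespace false -- mandated namespace of this single-conjunct summit

noncomputable section

open CategoryTheory AlgebraicGeometry TopologicalSpace Topology
open AlgebraicGeometry.Scheme.IdealSheafData
open Literature.AlgebraicGeometry.Resolution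

namespace Summit.ResolutionOfSingularities.ResolutionOfSingularities.Theorems.LocalToGlobal.HSTower

/-! ## Resolutions descend along the blind tower -/

/-- **Resolutions descend along one blind step** `V₁ → V` (it is proper and birational).
[folklore] -/
theorem NormalVariety.hasResolution_of_step {k : Type} [Field k] (N : ℕ) (V : NormalVariety k)
    (h : Scheme.HasResolution (V.step N).X) : Scheme.HasResolution V.X :=
  Scheme.HasResolution.of_isBirational (V.stepπ N) (V.isBirational_stepπ N) h

/-- **Resolutions descend along `n` blind steps**: if the stage `V_n = step^[n] V` of the blind
tower has a resolution, so does `V` (induction on `n` for all `V`, via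
`step^[n+1] V = step^[n] (step V)`). [folklore] -/
theorem NormalVariety.hasResolution_of_step_iterate {k : Type} [Field k] (N n : ℕ) :
    ∀ V : NormalVariety k, Scheme.HasResolution ((NormalVariety.step N)^[n] V).X →
      Scheme.HasResolution V.X := by
  induction n with
  | zero => intro V h; simpa only [Function.iterate_zero, id_eq] using h
  | succ n ih =>
    intro V h
    rw [Function.iterate_succ_apply] at h
    exact V.hasResolution_of_step N (ih (V.step N) h)

/-! ## The stub -/

/-- **Stub `stub_hasResolution_of_isRegular_iter` of line `Sketch` — (a regular stage resolves `V`).** `V_n → V` is proper and birational (composite of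
blind steps), so a regular `V_n` is a resolution of `V`. [folklore] -/
theorem stub_hasResolution_of_isRegular_iter (k : Type) [Field k] (N n : ℕ) :
    ∀ V : NormalVariety k, Scheme.IsRegular ((NormalVariety.step N)^[n] V).X →
      Scheme.HasResolution V.X :=
  fun V h => NormalVariety.hasResolution_of_step_iterate N n V h.hasResolution

end Summit.ResolutionOfSingularities.ResolutionOfSingularities.Theorems.LocalToGlobal.HSTower

end
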